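import Mathlib.Analysis.Matrix.Spectrum
import Mathlib.Analysis.Convex.Jensen
import Summits.AtomisticToContinuum.Crystallization.Theorems.ExcessDecayLiouvillePhononStabilityCertBlochDefs

/-!
# Near-certificate layer B5: the spectral-corner principle (lead c3, skeleton v10)

Support file for crux `PhononStability` (stmt-AtomisticToContinuum-9333), line `contragredient-window-collapse`.

Proof of `SpectralCornerPrinciple` (stub `stub_spectralCorner`): a function concave on the metric window
`Kmetric = {G symmetric : a² M₀ ⪯ G ⪯ b² M₀}` and nonnegative on the spectral corners `cornerSet` is nonnegative on
`Kmetric`.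

* `exists_cholesky_M0`: the explicit upper-triangular Cholesky factor `N` of `M₀ = Nᵀ N`, with explicit inverse
  and `N M₀⁻¹ Nᵀ = 1`.
* SIMULTANEOUS DIAGONALISATION (`exists_frame`): for symmetric `G`, the real spectral theorem applied to
  `Q = N⁻ᵀ G N⁻¹ = U diag(λ) Uᵀ` gives the frame `W = Uᵀ N` (rows `p_k`) with `G = Wᵀ diag(λ) W = Σ λ_k p_k p_kᵀ`,
  `Wᵀ W = M₀` and `W M₀⁻¹ Wᵀ = 1`.
* The congruence image `Wᵀ diag(μ) W` of the cube `[a², b²]³` lies in `Kmetric` (`frameSum_mem_Kmetric`), the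
  generalised eigenvalues `λ` of `G ∈ Kmetric` lie in the cube (`ev_mem_Icc`), and the `2³` vertices of the cube are
  mapped to `cornerSet` (`frameSum_vertex_mem_cornerSet`).
* The cube is the convex hull of its vertices (`convexHull_pi`), so the concave function `μ ↦ f (Wᵀ diag(μ) W)`
  attains a value `≤ f G` at a vertex (`ConcaveOn.exists_le_of_mem_convexHull`), where `f ≥ 0`. [folklore]
-/

noncomputable section

open scoped BigOperators
open Matrix

namespace Summit.AtomisticToContinuum.Crystallization.Theorems.PhononStabilityCWC.Cert

/-! ## The Cholesky factor of `M₀` -/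

/-- **Cholesky factor of `M₀`.**  There is an invertible `N` with `Nᵀ N = M₀` and `N M₀⁻¹ Nᵀ = 1`: explicitly the
upper-triangular `N = [[1, 1/2, 0], [0, √3/2, 0], [0, 0, 2√6/3]]` (its columns are the coordinates of the generators
`u, v, c`) with inverse `[[1, −√3/3, 0], [0, 2√3/3, 0], [0, 0, √6/4]]` (rows: the dual generators). [folklore] -/
theorem exists_cholesky_M0 :
    ∃ N Ninv : Matrix (Fin 3) (Fin 3) ℝ, Nᵀ * N = M0R ∧ Ninv * N = 1 ∧ N * M0invR * Nᵀ = 1 := by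
  have h3 : (√3 : ℝ) ^ 2 = 3 := Real.sq_sqrt (by norm_num)
  have h6 : (√6 : ℝ) ^ 2 = 6 := Real.sq_sqrt (by norm_num)
  refine ⟨!![1, 1 / 2, 0; 0, √3 / 2, 0; 0, 0, 2 * √6 / 3], !![1, -(√3 / 3), 0; 0, 2 * √3 / 3, 0; 0, 0, √6 / 4],
    ?_, ?_, ?_⟩
  · ext i j
    simp only [Matrix.mul_apply, Fin.sum_univ_three, transpose_apply]
    fin_cases i <;> fin_cases j <;> simp [M0R, M0Q] <;> nlinarith [h3, h6]
  · ext i j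
    simp only [Matrix.mul_apply, Fin.sum_univ_three]
    fin_cases i <;> fin_cases j <;> simp <;> nlinarith [h3, h6]
  · ext i j
    simp only [Matrix.mul_apply, Fin.sum_univ_three, transpose_apply]
    fin_cases i <;> fin_cases j <;> simp [M0invR, M0inv] <;> nlinarith [h3, h6]

/-! ## The real spectral theorem and the simultaneous diagonalisation of `(G, M₀)` -/

/-- Real spectral theorem in matrix form: a symmetric real `3 × 3` matrix is `U diag(λ) Uᵀ` with `U` orthogonal.
[folklore] -/
theorem isSymm_diagonalise {Q : Matrix (Fin 3) (Fin 3) ℝ} (hQ : Q.IsSymm) :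
    ∃ (U : Matrix (Fin 3) (Fin 3) ℝ) (ev : Fin 3 → ℝ), Q = U * diagonal ev * Uᵀ ∧ U * Uᵀ = 1 ∧ Uᵀ * U = 1 := by
  have hH : Q.IsHermitian := by
    change Qᴴ = Q
    rw [conjTranspose_eq_transpose_of_trivial]
    exact hQ
  set U : Matrix (Fin 3) (Fin 3) ℝ := (hH.eigenvectorUnitary : Matrix (Fin 3) (Fin 3) ℝ) with hU
  have hstar : star U = Uᵀ := by
    rw [star_eq_conjTranspose, conjTranspose_eq_transpose_of_trivial]
  refine ⟨U, hH.eigenvalues, ?_, ?_, ?_⟩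
  · have h := hH.spectral_theorem
    rw [Unitary.conjStarAlgAut_apply] at h
    rw [← hstar]
    simpa [RCLike.ofReal_real_eq_id] using h
  · rw [← hstar]
    exact Matrix.mem_unitaryGroup_iff.mp hH.eigenvectorUnitary.2
  · rw [← hstar]
    exact Matrix.mem_unitaryGroup_iff'.mp hH.eigenvectorUnitary.2

/-- **Simultaneous diagonalisation of `(G, M₀)`**: a symmetric `G` is `Wᵀ diag(λ) W` for a frame `W` with
`Wᵀ W = M₀` and `W M₀⁻¹ Wᵀ = 1` (i.e. the rows `p_k` of `W` satisfy `Σ p_k p_kᵀ = M₀`, `p_kᵀ M₀⁻¹ p_l = δ_kl`).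
[folklore] -/
theorem exists_frame {G : Matrix (Fin 3) (Fin 3) ℝ} (hG : G.IsSymm) :
    ∃ (W : Matrix (Fin 3) (Fin 3) ℝ) (ev : Fin 3 → ℝ),
      G = Wᵀ * diagonal ev * W ∧ Wᵀ * W = M0R ∧ W * M0invR * Wᵀ = 1 := by
  obtain ⟨N, Ninv, hNN, hNinv, hNM⟩ := exists_cholesky_M0
  -- the symmetric matrix `Q = N⁻ᵀ G N⁻¹`
  set Q : Matrix (Fin 3) (Fin 3) ℝ := Ninvᵀ * G * Ninv with hQdef
  have hQ : Q.IsSymm := by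
    unfold Matrix.IsSymm
    rw [hQdef, transpose_mul, transpose_mul, transpose_transpose, hG.eq, Matrix.mul_assoc]
  obtain ⟨U, ev, hspec, hU1, hU2⟩ := isSymm_diagonalise hQ
  refine ⟨Uᵀ * N, ev, ?_, ?_, ?_⟩
  · -- `G = Nᵀ (N⁻ᵀ G N⁻¹) N = Nᵀ Q N = Nᵀ U D Uᵀ N`
    have hN : G = Nᵀ * Q * N := by
      rw [hQdef]
      calc G = (Ninv * N)ᵀ * G * (Ninv * N) := by
            rw [hNinv, transpose_one, Matrix.one_mul, Matrix.mul_one]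
        _ = Nᵀ * (Ninvᵀ * G * Ninv) * N := by
            rw [transpose_mul]
            simp only [Matrix.mul_assoc]
    rw [hN, hspec, transpose_mul, transpose_transpose]
    simp only [Matrix.mul_assoc]
  · -- `(Uᵀ N)ᵀ (Uᵀ N) = Nᵀ (U Uᵀ) N = Nᵀ N = M₀`
    rw [transpose_mul, transpose_transpose, Matrix.mul_assoc, ← Matrix.mul_assoc U, hU1, Matrix.one_mul, hNN]
  · -- `Uᵀ N M₀⁻¹ Nᵀ U = Uᵀ U = 1`
    rw [transpose_mul, transpose_transpose, Matrix.mul_assoc Uᵀ, ← Matrix.mul_assoc (Uᵀ * (N * M0invR)) Nᵀ U,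
      Matrix.mul_assoc Uᵀ (N * M0invR) Nᵀ, hNM, Matrix.mul_one, hU2]

/-! ## The congruence image of the eigenvalue cube -/

/-- Entries of the congruence image: `(Wᵀ diag(μ) W)_{ij} = Σ_k μ_k W_{ki} W_{kj}`. [folklore] -/
theorem frameSum_apply (W : Matrix (Fin 3) (Fin 3) ℝ) (μ : Fin 3 → ℝ) (i j : Fin 3) :
    (Wᵀ * diagonal μ * W) i j = ∑ k, μ k * (W k i * W k j) := by
  rw [Matrix.mul_apply]
  simp only [mul_diagonal, transpose_apply]
  exact Finset.sum_congr rfl fun k _ => by ring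

/-- The congruence image is linear in `μ` (convex-combination form). [folklore] -/
theorem frameSum_add_smul (W : Matrix (Fin 3) (Fin 3) ℝ) (a b : ℝ) (x z : Fin 3 → ℝ) :
    Wᵀ * diagonal (a • x + b • z) * W = a • (Wᵀ * diagonal x * W) + b • (Wᵀ * diagonal z * W) := by
  ext i j
  simp only [frameSum_apply, Matrix.add_apply, Matrix.smul_apply, Pi.add_apply, Pi.smul_apply, smul_eq_mul,
    Fin.sum_univ_three]
  ring

/-- The quadratic form of the congruence image: `yᵀ (Wᵀ diag(μ) W) y = Σ_k μ_k (p_k · y)²`. [folklore] -/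
theorem quadR_frameSum (W : Matrix (Fin 3) (Fin 3) ℝ) (μ y : Fin 3 → ℝ) :
    quadR (Wᵀ * diagonal μ * W) y = ∑ k, μ k * (∑ i, W k i * y i) ^ 2 := by
  simp only [quadR, frameSum_apply, Fin.sum_univ_three]
  ring

/-- `yᵀ M₀ y = Σ_k (p_k · y)²` for a frame with `Wᵀ W = M₀`. [folklore] -/
theorem quadR_M0R_frame {W : Matrix (Fin 3) (Fin 3) ℝ} (hWW : Wᵀ * W = M0R) (y : Fin 3 → ℝ) :
    quadR M0R y = ∑ k, (∑ i, W k i * y i) ^ 2 := by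
  have h : M0R = Wᵀ * diagonal (fun _ => 1) * W := by
    rw [show (diagonal fun _ : Fin 3 => (1 : ℝ)) = 1 from diagonal_one, Matrix.mul_one, hWW]
  rw [h, quadR_frameSum]
  simp

/-- **The congruence image of the cube `[a², b²]³` lies in the window `Kmetric`.** [folklore] -/
theorem frameSum_mem_Kmetric {W : Matrix (Fin 3) (Fin 3) ℝ} (hWW : Wᵀ * W = M0R) {μ : Fin 3 → ℝ}
    (hμ : ∀ k, aSq ≤ μ k ∧ μ k ≤ bSq) : Wᵀ * diagonal μ * W ∈ Kmetric := by
  refine ⟨?_, fun y => ?_⟩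
  · unfold Matrix.IsSymm
    rw [transpose_mul, transpose_mul, transpose_transpose, diagonal_transpose, Matrix.mul_assoc]
  · rw [quadR_frameSum, quadR_M0R_frame hWW, Finset.mul_sum, Finset.mul_sum]
    exact ⟨Finset.sum_le_sum fun k _ => mul_le_mul_of_nonneg_right (hμ k).1 (sq_nonneg _),
      Finset.sum_le_sum fun k _ => mul_le_mul_of_nonneg_right (hμ k).2 (sq_nonneg _)⟩

/-- Duality of the frame: `p_lᵀ M₀⁻¹ p_k = δ_lk`. [folklore] -/
theorem frame_dual {W : Matrix (Fin 3) (Fin 3) ℝ} (hWM : W * M0invR * Wᵀ = 1) (l k : Fin 3) :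
    ∑ i, W l i * (∑ j, M0invR i j * W k j) = (1 : Matrix (Fin 3) (Fin 3) ℝ) l k := by
  rw [← hWM]
  simp only [Matrix.mul_apply, transpose_apply, Finset.sum_mul, Finset.mul_sum]
  rw [Finset.sum_comm]
  exact Finset.sum_congr rfl fun i _ => Finset.sum_congr rfl fun j _ => by ring

/-- `p_kᵀ M₀⁻¹ p_k = 1`: the rows of the frame lie on the corner ellipsoid. [folklore] -/
theorem quadR_M0invR_row {W : Matrix (Fin 3) (Fin 3) ℝ} (hWM : W * M0invR * Wᵀ = 1) (k : Fin 3) :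
    quadR M0invR (W k) = 1 := by
  have h := frame_dual hWM k k
  rw [Matrix.one_apply_eq] at h
  rw [← h, quadR]
  simp only [Finset.mul_sum]
  exact Finset.sum_congr rfl fun i _ => Finset.sum_congr rfl fun j _ => by ring

/-- **The generalised eigenvalues of `G ∈ Kmetric` lie in `[a², b²]`** (test `Kmetric` at `y = M₀⁻¹ p_k`).
[folklore] -/
theorem ev_mem_Icc {G W : Matrix (Fin 3) (Fin 3) ℝ} {ev : Fin 3 → ℝ} (hG : G ∈ Kmetric)
    (hGW : G = Wᵀ * diagonal ev * W)
    (hWW : Wᵀ * W = M0R) (hWM : W * M0invR * Wᵀ = 1) (k : Fin 3) : aSq ≤ ev k ∧ ev k ≤ bSq := by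
  set y : Fin 3 → ℝ := fun i => ∑ j, M0invR i j * W k j with hy
  have hdual : ∀ l, ∑ i, W l i * y i = (1 : Matrix (Fin 3) (Fin 3) ℝ) l k := fun l => frame_dual hWM l k
  have h1 : quadR G y = ev k := by
    rw [hGW, quadR_frameSum]
    simp only [hdual]
    simp [Matrix.one_apply]
  have h2 : quadR M0R y = 1 := by
    rw [quadR_M0R_frame hWW]
    simp only [hdual]
    simp [Matrix.one_apply]
  have h := hG.2 y
  rw [h1, h2, mul_one, mul_one] at h
  exact h

/-! ## The vertices of the cube are mapped to the spectral corners -/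

/-- A vertex pattern `μ = (s, …, t at k, …, s)` is mapped to `s M₀ + (t − s) p_k p_kᵀ`. [folklore] -/
theorem frameSum_pattern {W : Matrix (Fin 3) (Fin 3) ℝ} (hWW : Wᵀ * W = M0R) {μ : Fin 3 → ℝ} (k : Fin 3)
    {s t : ℝ} (hμ : ∀ j, μ j = if j = k then t else s) :
    Wᵀ * diagonal μ * W = s • M0R + (t - s) • vecMulVec (W k) (W k) := by
  ext i j
  have hM : M0R i j = ∑ l, W l i * W l j := by
    rw [← hWW, Matrix.mul_apply]
    rfl
  rw [frameSum_apply]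
  simp only [Matrix.add_apply, Matrix.smul_apply, vecMulVec_apply, smul_eq_mul, hM, hμ, Fin.sum_univ_three]
  fin_cases k <;> simp <;> ring

/-- A vertex pattern with values in `{a², b²}` is mapped into `cornerSet`. [folklore] -/
theorem corner_of_pattern {W : Matrix (Fin 3) (Fin 3) ℝ} (hWW : Wᵀ * W = M0R) (hWM : W * M0invR * Wᵀ = 1)
    {μ : Fin 3 → ℝ} (k : Fin 3) {s t : ℝ} (hs : s = aSq ∨ s = bSq) (ht : t = aSq ∨ t = bSq)
    (hμ : ∀ j, μ j = if j = k then t else s) : Wᵀ * diagonal μ * W ∈ cornerSet := by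
  have hq : quadR M0invR (W k) = 1 := quadR_M0invR_row hWM k
  rw [frameSum_pattern hWW k hμ]
  simp only [cornerSet, Set.mem_union, Set.mem_insert_iff, Set.mem_singleton_iff, Set.mem_setOf_eq]
  rcases hs with rfl | rfl <;> rcases ht with rfl | rfl
  · exact Or.inl (Or.inl (by simp))
  · exact Or.inr ⟨W k, hq, Or.inr rfl⟩
  · refine Or.inr ⟨W k, hq, Or.inl ?_⟩
    ext i j
    simp only [Matrix.add_apply, Matrix.sub_apply, Matrix.smul_apply, smul_eq_mul]
    ring
  · exact Or.inl (Or.inr (by simp))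

/-- **Every vertex of the cube `{a², b²}³` is mapped to a spectral corner.** [folklore] -/
theorem frameSum_vertex_mem_cornerSet {W : Matrix (Fin 3) (Fin 3) ℝ} (hWW : Wᵀ * W = M0R)
    (hWM : W * M0invR * Wᵀ = 1) {μ : Fin 3 → ℝ} (hv : ∀ i, μ i = aSq ∨ μ i = bSq) :
    Wᵀ * diagonal μ * W ∈ cornerSet := by
  rcases hv 0 with h0 | h0 <;> rcases hv 1 with h1 | h1 <;> rcases hv 2 with h2 | h2
  · exact corner_of_pattern hWW hWM 0 (s := aSq) (t := aSq) (Or.inl rfl) (Or.inl rfl)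
      fun j => by fin_cases j <;> simp [h0, h1, h2]
  · exact corner_of_pattern hWW hWM 2 (s := aSq) (t := bSq) (Or.inl rfl) (Or.inr rfl)
      fun j => by fin_cases j <;> simp [h0, h1, h2]
  · exact corner_of_pattern hWW hWM 1 (s := aSq) (t := bSq) (Or.inl rfl) (Or.inr rfl)
      fun j => by fin_cases j <;> simp [h0, h1, h2]
  · exact corner_of_pattern hWW hWM 0 (s := bSq) (t := aSq) (Or.inr rfl) (Or.inl rfl)
      fun j => by fin_cases j <;> simp [h0, h1, h2]
  · exact corner_of_pattern hWW hWM 0 (s := aSq) (t := bSq) (Or.inl rfl) (Or.inr rfl)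
      fun j => by fin_cases j <;> simp [h0, h1, h2]
  · exact corner_of_pattern hWW hWM 1 (s := bSq) (t := aSq) (Or.inr rfl) (Or.inl rfl)
      fun j => by fin_cases j <;> simp [h0, h1, h2]
  · exact corner_of_pattern hWW hWM 2 (s := bSq) (t := aSq) (Or.inr rfl) (Or.inl rfl)
      fun j => by fin_cases j <;> simp [h0, h1, h2]
  · exact corner_of_pattern hWW hWM 0 (s := bSq) (t := bSq) (Or.inr rfl) (Or.inr rfl)
      fun j => by fin_cases j <;> simp [h0, h1, h2]

/-! ## The cube as a convex hull, and the principle -/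

/-- `a² < b²`. [folklore] -/
theorem aSq_lt_bSq : aSq < bSq := by norm_num [aSq, bSq]

/-- The cube `[a², b²]³` is the convex hull of its vertex set. [folklore] -/
theorem convexHull_cubeVert :
    convexHull ℝ (Set.univ.pi fun _ : Fin 3 => ({aSq, bSq} : Set ℝ)) = Set.univ.pi fun _ => Set.Icc aSq bSq := by
  rw [convexHull_pi]
  refine congrArg _ (funext fun _ => ?_)
  rw [convexHull_pair, segment_eq_Icc aSq_lt_bSq.le]

/-- **STUB B5 — THE SPECTRAL CORNER PRINCIPLE.**  A function concave on the metric window `Kmetric` and nonnegative on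
the spectral corners `cornerSet` is nonnegative on `Kmetric`: simultaneous diagonalisation of `(G, M₀)` writes
`G = Σ λ_k p_k p_kᵀ` with `λ ∈ [a², b²]³`, the congruence image of the cube lies in `Kmetric` with its vertices in
`cornerSet`, and a concave function on a cube is minimised at a vertex. [folklore] -/
theorem stub_spectralCorner : SpectralCornerPrinciple := by
  intro f hf hcorner G hG
  obtain ⟨W, ev, hGW, hWW, hWM⟩ := exists_frame hG.1
  set V : Set (Fin 3 → ℝ) := Set.univ.pi fun _ : Fin 3 => ({aSq, bSq} : Set ℝ)
  have hcube : convexHull ℝ V = Set.univ.pi fun _ => Set.Icc aSq bSq := convexHull_cubeVert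
  have hev : ev ∈ convexHull ℝ V := by
    rw [hcube]
    exact Set.mem_univ_pi.mpr fun k => ev_mem_Icc hG hGW hWW hWM k
  have hconc : ConcaveOn ℝ (convexHull ℝ V) fun μ => f (Wᵀ * diagonal μ * W) := by
    refine ⟨convex_convexHull ℝ _, fun x hx z hz a b ha hb hab => ?_⟩
    rw [hcube, Set.mem_univ_pi] at hx hz
    have h := hf.2 (frameSum_mem_Kmetric hWW fun k => hx k) (frameSum_mem_Kmetric hWW fun k => hz k) ha hb hab
    simpa only [frameSum_add_smul] using h
  obtain ⟨y, hyV, hy⟩ := hconc.exists_le_of_mem_convexHull (subset_convexHull ℝ V) hev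
  have hyv : ∀ i, y i = aSq ∨ y i = bSq := fun i => by
    simpa using Set.mem_univ_pi.mp hyV i
  calc (0 : ℝ) ≤ f (Wᵀ * diagonal y * W) := hcorner _ (frameSum_vertex_mem_cornerSet hWW hWM hyv)
    _ ≤ f (Wᵀ * diagonal ev * W) := hy
    _ = f G := by rw [hGW]

end Summit.AtomisticToContinuum.Crystallization.Theorems.PhononStabilityCWC.Cert

end
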